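import Summits.RiemannHypothesis.RiemannHypothesis.Theorems.ZetaStringKernelOfWeilOn
import Summits.RiemannHypothesis.RiemannHypothesis.Theorems.ZetaStringArchWallTies
import Literature.NumberTheory.LFunctions.WeilArchimedeanPositivityHolds
import HarnessLib

/-!
# ZetaStringArchWall — the wall HOLDS up to the first prime: `ArchWallHolds (log 2)` (column DBR; RH-FREE)

LINE 1 — LABEL: RH-FREE structural facts about the explicit prime-free function `Ψ_∅` (the "archimedean wall"
of Suzuki's screw function) and RH-FREE glue; `ArchWallHolds (log 2)` is Yoshida's archimedean Weil rung
`WeilPositivityOn ((log 2)/2)` RE-INDEXED as a Kreĭn-kernel statement (tautology label: Weil positivity at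
depth `(log 2)/2` in another coordinate). bears_on: LADDER-RH B-D → B-P(P1) (cell rh-dbr, ET6 row `N = 2`,
TARGET-v7 §K.2). WHAT THIS IS NOT: not progress toward RH; the positivity radius of the wall is a property
of one explicit special function; nothing here bears on the truth of RH.

Typed targets (`Theorems/ZetaStringArchWallDefs.lean`, theory memo TARGET-v7 §K.2): `ArchWallHolds ℓ` = the
kernel `Ψ_∅(t) + Ψ_∅(u) − Ψ_∅(t − u)` is positive semidefinite on finite configurations in `(0, ℓ)`;
`ArchWallTies ℓ̄` = it is not, on `(0, ℓ̄)`. The tree already holds `archWallTies_three_quarters`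
(kernel certificate, [rh-dbr-eng] g4). This file proves the positivity side up to the prime-free edge:

* `isPosSemidefKernelOn_zetaScrewKernel_Ioo_zero_of_symm` — window bookkeeping: PSD of `G = zetaScrewKernel` on
  the symmetric window `(−a, a)` ⟹ PSD on the one-sided window `(0, 2a)` (the augmented zero-sum form only
  sees differences; recentre at the midpoint of the range);
* `isPosSemidefKernelOn_zetaScrewKernel_Ioo_zero_of_weilPositivityOn` — `WeilPositivityOn a` ⟹ `G` PSD on
  `(0, 2a)` (with the converse window dictionary `KernelOfWeilOn.isPosSemidefKernelOn_zetaScrewKernel_of_weilPositivityOn`);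
* `archWallHolds_log_two : ArchWallHolds (Real.log 2)` — from `weilPositivityOn_log_two_half_holds` and
  `Ψ_∅ = Ψ` on `|v| < log 2`; `archWallHolds_of_le_log_two`, `ArchWallHolds.mono`;
* `archWall_bracket_log_two : ArchWallHolds (log 2) ∧ ArchWallTies (3/4)` — the TREE BRACKET
  `log 2 ≤ ℓ*(∅) ≤ 3/4` for the wall's one-sided positivity radius (ET6 numerics of record, eng-5 g0:
  `ℓ*(∅) = 0.74320`, certified tie `≤ 0.743227`; `a_∞* = ℓ*(∅)/2 ∈ [0.3466, 0.375]` in the normalisation of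
  the dormant PluckedString item `ArchWallDepth`). The typed `ArchWallBracket` (holds at `0.74`) is STRONGER and
  stays open: the sliver `(log 2, ℓ*(∅))`, where the wall holds on its own beyond the prime-free window, needs a
  dual (coercivity) certificate and is not claimed here.

References: H. Yoshida, *On Hermitian forms attached to zeta functions*, Adv. Stud. Pure Math. 21 (1992), Thm 1;
M. Suzuki, J. Lond. Math. Soc. (2) 108 (2023) = arXiv:2206.03682, (1.1), (1.4)–(1.5), Prop. 3.1, Thm 4.2.
-/

-- `Summit.RiemannHypothesis.RiemannHypothesis.…` duplicates `RiemannHypothesis` BY DESIGN (D-0017).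
set_option linter.dupNamespace false

noncomputable section

open scoped BigOperators

namespace Summit.RiemannHypothesis.RiemannHypothesis.Theorems.ZetaStringArchWall

open Literature.NumberTheory.LFunctions Literature.Analysis.Complex
open Summit.RiemannHypothesis.RiemannHypothesis.Theorems.KernelOfWeilOn

/-! ## §1 Window bookkeeping: `(−a, a)` versus `(0, 2a)` (translation invariance of the zero-sum form) -/

/-- **Translation to the one-sided window.** If `G = Ψ(t)+Ψ(u)−Ψ(t−u)` is positive semidefinite on the
symmetric open window `(−a, a)`, it is positive semidefinite on the one-sided window `(0, 2a)`: the augmented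
zero-sum form `−Σ wᵢwⱼ Ψ(sᵢ − sⱼ)` only sees differences, and a configuration in `[0, 2a)` recentred at the
midpoint of its range lies in `(−a, a)`. (Both statements say: `Ψ` is conditionally negative definite on
zero-sum configurations of diameter `< 2a`; one-sided window `ℓ = 2a` ↔ symmetric half-width `a`.) [folklore] -/
theorem isPosSemidefKernelOn_zetaScrewKernel_Ioo_zero_of_symm {a : ℝ}
    (h : IsPosSemidefKernelOn (fun t u : ℝ => (zetaScrewKernel t u : ℂ)) (Set.Ioo (-a) a)) :
    IsPosSemidefKernelOn (fun t u : ℝ => (zetaScrewKernel t u : ℂ)) (Set.Ioo 0 (2 * a)) := by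
  rw [isPosSemidefKernelOn_zetaScrewKernel_iff] at h ⊢
  intro N t x ht
  rcases Nat.eq_zero_or_pos N with hN | hN
  · subst hN; simp
  -- augmented zero-sum system on `[0, 2a)`
  set s : Fin (N + 1) → ℝ := Fin.cons 0 t with hsdef
  set w : Fin (N + 1) → ℝ := Fin.cons (-∑ i, x i) x with hwdef
  have hs0 : ∀ i, 0 ≤ s i := fun i => by
    refine Fin.cases ?_ (fun i => ?_) i
    · simp [hsdef]
    · simpa [hsdef] using (ht i).1.le
  have hs2 : ∀ i, s i < 2 * a := fun i => by
    refine Fin.cases ?_ (fun i => ?_) i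
    · have h0 := ht ⟨0, hN⟩
      simp only [hsdef, Fin.cons_zero]
      exact h0.1.trans h0.2
    · simpa [hsdef] using (ht i).2
  have hw : ∑ i, w i = 0 := by simp [hwdef, Fin.sum_univ_succ]
  -- midpoint recentring
  have hne : (Finset.univ : Finset (Fin (N + 1))).Nonempty := Finset.univ_nonempty
  obtain ⟨iM, -, hiM⟩ := Finset.exists_mem_eq_sup' hne s
  obtain ⟨im, -, him⟩ := Finset.exists_mem_eq_inf' hne s
  set c : ℝ := (Finset.univ.sup' hne s + Finset.univ.inf' hne s) / 2 with hcdef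
  have hs' : ∀ i, s i - c ∈ Set.Ioo (-a) a := by
    intro i
    have h1 : s i ≤ Finset.univ.sup' hne s := Finset.le_sup' s (Finset.mem_univ i)
    have h2 : Finset.univ.inf' hne s ≤ s i := Finset.inf'_le s (Finset.mem_univ i)
    have h3 := hs2 iM
    have h4 := hs0 im
    rw [← hiM] at h3
    rw [← him] at h4
    constructor <;> linarith
  have key := h (N + 1) (fun i => s i - c) w hs'
  -- the recentred kernel form is the zero-sum form in the differences `sᵢ − sⱼ`
  have e1 : ∑ i, ∑ j, zetaScrewKernel (s i - c) (s j - c) * (w i * w j) =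
      -∑ i, ∑ j, w i * w j * zetaScrew (s i - s j) := by
    have e2 : ∀ i j, zetaScrewKernel (s i - c) (s j - c) * (w i * w j) =
        w i * w j * zetaScrew (s i - c) + w i * w j * zetaScrew (s j - c)
          - w i * w j * zetaScrew (s i - s j) := by
      intro i j
      rw [zetaScrewKernel, sub_sub_sub_cancel_right]
      ring
    simp only [e2, Finset.sum_add_distrib, Finset.sum_sub_distrib,
      Suzuki2023Thm42.sum_sum_mul_mul_eq_zero_left w hw (fun i => zetaScrew (s i - c)),
      Suzuki2023Thm42.sum_sum_mul_mul_eq_zero_right w hw (fun j => zetaScrew (s j - c))]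
    ring
  rw [Suzuki2023Thm42.sum_sum_zetaScrewKernel_eq_neg t x]
  rw [e1] at key
  simpa [hsdef, hwdef] using key

/-- **Weil rung ⟹ one-sided Kreĭn window.** `WeilPositivityOn a` (symmetric half-width `a`) gives
positive semidefiniteness of `G` on configurations in `(0, 2a)` (one-sided window `ℓ = 2a`). RH-FREE glue.
[cite: Suzuki2023, (1.5) and Prop 3.1] -/
theorem isPosSemidefKernelOn_zetaScrewKernel_Ioo_zero_of_weilPositivityOn {a : ℝ}
    (hW : WeilPositivityOn a) :
    IsPosSemidefKernelOn (fun t u : ℝ => (zetaScrewKernel t u : ℂ)) (Set.Ioo 0 (2 * a)) :=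
  isPosSemidefKernelOn_zetaScrewKernel_Ioo_zero_of_symm
    (isPosSemidefKernelOn_zetaScrewKernel_of_weilPositivityOn hW)

/-! ## §2 The archimedean wall holds up to the first prime: `ArchWallHolds (log 2)` -/

/-- On the prime-free window the wall kernel IS Suzuki's kernel: for `t, u ∈ (0, log 2)` all of `|t|, |u|,
|t − u|` are `< log 2`, where `Ψ_∅ = Ψ` (`archScrew_eq_zetaScrew_of_abs_lt_log_two`). [folklore] -/
theorem archKernel_eq_of_mem {t u : ℝ} (ht : t ∈ Set.Ioo 0 (Real.log 2)) (hu : u ∈ Set.Ioo 0 (Real.log 2)) :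
    archKernel t u = (zetaScrewKernel t u : ℂ) := by
  have h1 : |t| < Real.log 2 := by rw [abs_of_pos ht.1]; exact ht.2
  have h2 : |u| < Real.log 2 := by rw [abs_of_pos hu.1]; exact hu.2
  have h3 : |t - u| < Real.log 2 := by
    rw [abs_sub_lt_iff]
    constructor <;> linarith [ht.1, ht.2, hu.1, hu.2]
  simp only [archKernel, zetaScrewKernel, archScrew_eq_zetaScrew_of_abs_lt_log_two h1,
    archScrew_eq_zetaScrew_of_abs_lt_log_two h2, archScrew_eq_zetaScrew_of_abs_lt_log_two h3]

/-- **`ArchWallHolds (log 2)`** — RH-FREE: the archimedean wall `Ψ_∅(t) + Ψ_∅(u) − Ψ_∅(t − u)` is positive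
semidefinite on every finite configuration in `(0, log 2)`. Proof: Yoshida's archimedean rung
`WeilPositivityOn ((log 2)/2)` (`weilPositivityOn_log_two_half_holds`, kernel-certified in the tree) ⟹
`G` is PSD on `(0, log 2)` (converse window dictionary + translation) and `G = archKernel` there.
Together with `archWallTies_three_quarters` this brackets the wall's one-sided positivity radius:
`log 2 ≤ ℓ*(∅) ≤ 3/4` (ET6 numerics of record: `ℓ*(∅) = 0.74320`, certified tie `≤ 0.743227`); the sliver
`(log 2, ℓ*(∅))`, where the wall holds on its own beyond the prime-free window, is NOT claimed here.
TAUTOLOGY LABEL: Weil positivity at depth `(log 2)/2` re-indexed as a Kreĭn-kernel statement; nothing here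
bears on RH. [cite: Yoshida1992, Thm 1; Suzuki2023, (1.5), Prop 3.1] -/
theorem archWallHolds_log_two : ArchWallHolds (Real.log 2) := by
  have h : IsPosSemidefKernelOn (fun t u : ℝ => (zetaScrewKernel t u : ℂ)) (Set.Ioo 0 (Real.log 2)) := by
    have h2 := isPosSemidefKernelOn_zetaScrewKernel_Ioo_zero_of_weilPositivityOn
      weilPositivityOn_log_two_half_holds
    have e : 2 * (Real.log 2 / 2) = Real.log 2 := mul_div_cancel₀ _ (two_ne_zero' ℝ)
    exact e ▸ h2
  intro m x hx c
  have e : ∀ i j, archKernel (x i) (x j) = (zetaScrewKernel (x i) (x j) : ℂ) := fun i j =>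
    archKernel_eq_of_mem (hx i) (hx j)
  simp only [e]
  exact h m x hx c

/-- Monotonicity of the positive statement: the wall holds on every shorter window. [folklore] -/
theorem ArchWallHolds.mono {l l' : ℝ} (h : ArchWallHolds l') (hle : l ≤ l') : ArchWallHolds l :=
  IsPosSemidefKernelOn.mono h (Set.Ioo_subset_Ioo_right hle)

/-- RH-FREE: `ArchWallHolds ℓ` for every `ℓ ≤ log 2`. [cite: Yoshida1992, Thm 1] -/
theorem archWallHolds_of_le_log_two {l : ℝ} (hl : l ≤ Real.log 2) : ArchWallHolds l :=
  archWallHolds_log_two.mono hl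

/-- **The tree bracket for ET6 row `N = 2`** (RH-FREE finite/structural facts about `Ψ_∅`): the wall HOLDS on
`(0, log 2)` and TIES inside `(0, 3/4)`; i.e. the one-sided positivity radius of the archimedean part of the
explicit formula satisfies `log 2 = 0.6931… ≤ ℓ*(∅) ≤ 3/4` (a_∞* ∈ [(log 2)/2, 3/8] in the symmetric
normalisation of PluckedString `ArchWallDepth`). The typed `ArchWallBracket` (holds at `0.74`) is stronger
and remains open (dual certificate). [cite: Yoshida1992, Thm 1; Suzuki2023, (1.5)] -/
theorem archWall_bracket_log_two : ArchWallHolds (Real.log 2) ∧ ArchWallTies (3 / 4) :=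
  ⟨archWallHolds_log_two, archWallTies_three_quarters⟩

end Summit.RiemannHypothesis.RiemannHypothesis.Theorems.ZetaStringArchWall

end
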